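import Mathlib
import HarnessLib
import HarnessLib.Audit
import Summits.PneNP.Statement
import Literature.Computability.Complexity.Classes
import Literature.Computability.Complexity.Nondeterministic
import Literature.Computability.Complexity.CookBridges
import Literature.Computability.Complexity.BoolEncodings
import Literature.Barriers.PneNP.NOFLogNBarrier

/-!
Route: RootDecompMultipartyNOF

DORMANT since 2026-09-04T13:54:27Z (reconciler: no traction for 5 d (last activity statement-checked at 2026-08-30T13:21:56Z); parked, not closed — `ledger route dormant route-PneNP-RootDecompMultipartyNOF --off` to reactivate) — unstaffed, not closed; items shared with open routes are served there. `ledger route dormant <id> --off` reactivates.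

Root-decomposition cell decomp-pnenp (D-0178), node N31 = proposal P31 (lens-4 gen 9
«RootDecompMultipartyNOF», HOME/decomp-pnenp-lens-4/CommunicationLift.lean sha256 87b2f764; critic
CLEARED 2026-08-30T07:51:49Z). It suffices to show the two pieces of the law-D cut of P ≠ NP along
the NEW coordinate «number of number-on-forehead players admitted», cut at the log n BARRIER class
NOFEasy (polylog players, polylog simultaneous cost per player = the Håstad–Goldmann shape of every
ACC⁰ function): NOFTransfer «P = NP ⟹ some polynomial-time language lies outside the log n barrier»
(attacked; normal form S ∨ BreakLogNBarrierInP) and NOFShallow «P = NP ⟹ P ⊆ NOFEasy», i.e. «an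
explicit P-function beyond the log n barrier already proves P ≠ NP» (declared residual, pre-costume
mod the famous-open road BreakLogNBarrierInP). S ⟺ NOFTransfer ∧ NOFShallow hypothesis-free (pack
pneNP_iff); the dial is calibrated in kernel at both ends (two players: transfer a theorem;
⌊N/(t+1)⌋ players: shallowness a theorem).
Lean: NOFTransfer → NOFShallow → PneNP

Rationale: WHY THIS LINE. Every cut of the cell so far lives on a circuit-class axis (depth, modulus, width,
size); this node cuts along a COMMUNICATION measure — the number of NOF players a language's slices
tolerate with polylog simultaneous cost — whose threshold class NOFEasy contains ACC⁰ by the tree's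
PROVED Håstad–Goldmann simulation (mod the one named fact ACC⁰ ⊆ SYM⁺). The attacked piece therefore
sits ABOVE N4's TransferACC0 and the residual BELOW N4's ShallowAlgorithmica (lens kernel), and the
S-free road is the central open problem of multiparty communication complexity (break the log n
barrier with an explicit function — here a P-language), with a registered candidate in the tree
(WideBlockMajMajConjecture, k = 2 fragment proved). Imported from elsewhere: NOF communication
complexity (BNS discrepancy, Håstad–Goldmann, ACFN composed-function barrier, Hamoudi block width).
RANKED CRUXES. r2 NOFTransfer (attacked; road BreakLogNBarrierInP; candidate
WideBlockMajMajConjecture via the lens's unproved routine bridge WideBlockBridge). r3 NOFShallow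
(declared residual; pre-costume mod the road; below 23746 mod Williams2014_symPlus_of_acc). Asides
(banked): BreakLogNBarrierInP (located S-free sub-target, famous-open, never staffed), TransferAtOne
(two-player calibration, decided in the lens kernel, provable-now port).
KILL CRITERIA. (k1) A proof of P ⊆ NOFEasy (nobody believes it) makes NOFTransfer ≡ S and NOFShallow
a theorem — retire located-costume; (k2) a proof of BreakLogNBarrierInP makes NOFShallow ≡ S
(pre-costume, declared) and NOFTransfer a theorem — node DECIDED with residual = S: bank A_NOF,
retire as costume-by-theorem (census law III / LAW IV); (k3) a refuted WideBlockMajMajConjecture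
removes the candidate, not the node; (k4) a typed relativized world NP ⊆ P ∧ P ⊆ NOFEasy over the
tree's oracle classes prices NOFTransfer as needing non-relativizing transfer (placement, not a
kill).
NOT DECOMPOSED YET. The bridge WideBlockBridge (language engineering: one P-language laying out all
(c,t) instances of majMajNOF at distinct lengths; the lens's quantifier audit ∃e-vs-∀c) is not filed
as an item because it reaches a registered @[conjecture]; the dial rows TransferAt (plog e) /
ShallowAt width t beyond the two calibration ends; the SAT/ILP profile of small majMajNOF SMP costs
(instrument, ≈ 5–20 core-h, not run).
CHEAPEST FALSIFIER. In Lean: `#h21_crux_probe` on both pieces vs PneNP (run: CLEAN, C → S fails;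
pack) and the lens's must-fail probes (C → S ×2, piece ↛ piece ×2, outright ×2, NOFEasy = ∅ / =
univ, BreakLogNBarrierInP outright — all fail; NOFEasy inhabited by MAJ in kernel). In print: an
explicit function with a deterministic simultaneous NOF lower bound at k ≥ log₂ N players would
close the road — searched (ACFN 2015, Hamoudi 2018, Podolskii–Sherstov 2020, Jukna Ch. 5/12): none.

Novelty: Searches RUN (lens g9 + critic + writer): `lean search
'HasSimultaneousProtocol|NOFInput|WideBlockMajMaj'` / `rg NOFEasy lean/` (tree: the NOF model, ACFN
Thm 2 barrier NOFLogNBarrier, Håstad–Goldmann hasSimultaneousProtocol_of_acc, the registered open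
WideBlockMajMajConjecture and its k = 2 fragment; NO decl cutting P or Algorithmica by a player
threshold); `ledger negatives --problem PneNP` (no statement on NOF classes); corpus:
[corpus:paper:doi-10-1007-s00037-013-0078-4 pp.2,4,6] (ACFN: the log n barrier for composed
functions, «a formidable barrier»),
[corpus:book:jukna2012-boolean-function-complexity-advances-frontiers pp.168,372] (Rem. 5.20, Lemma
12.34 / Rem. 12.36: polylog-player lower bounds ⟹ outside ACC⁰), [corpus:arXiv:1710.01969] (Hamoudi:
block-width barrier Thm 12, MAJ∘MAJ_t conjecture §4; [galaxy:pdf:576415020]),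
[corpus:arXiv:1711.10661] (Podolskii–Sherstov: randomised Θ(log n) past the barrier),
[corpus:book:arora2009-computational-complexity-modern-approach p.596] (PRF candidates in TC⁰).
NEAREST PRIOR ART: Håstad–Goldmann 1991 / Jukna Rem. 12.36 (NOF lower bounds at polylog players ⟹
ACC⁰ lower bounds) — an S-free implication toward circuit classes, never a cut of P vs NP; ACFN 2015
/ Hamoudi 2018 (the barrier theorems, tree). NEAREST ROUTES: N4 RootDecompAccTransfer (TransferACC0
23745 ⟸ A_NOF; ShallowAlgorithmica 23746 ⟹ B_NOF, both mod Williams2014_symPlus_of_acc — probes fail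
the converse directions), N26 RootDecompBranchingProgram (width measure; dif  [refs: 1710.01969, 1711.10661, paper:doi-10-1007-s00037-013-0078-4, book:jukna2012-boolean-function-complexity-advances-frontiers, book:arora2009-computational-complexity-modern-approach]

Barriers (technique_class: NOF communication dial, collapse transfer, law-D carving): - technique_class: NOF communication lower bounds (discrepancy / cube norm, fooling sets,
Håstad–Goldmann SYM⁺ simulation) on a player-threshold dial; collapse transfer; law-D carving
- Literature.Barriers.PneNP.NOFLogNBarrier (ACFN 2015 Thm 2; with NOFBlockWidthBarrier, Hamoudi Thm
12): the ROAD BreakLogNBarrierInP is INSIDE the class «deterministic simultaneous NOF lower bounds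
at polylog players» — the catalogued theorems quantify over block width ONE (ACFN) and CONSTANT
width (Hamoudi), so the evasion of record is GROWING block width (the wide-block MAJ∘MAJ_t
candidate, registered open conjecture); priced IDEA-NEEDED + BARRIER-ADJACENT, not claimed evaded.
The pieces themselves carry NP ⊆ P and are not statements the barrier quantifies over.
- Literature.Barriers.PneNP.NaturalProofs / Literature.Barriers.PneNP.NaturalProofsTC0 (RR97,
Naor–Reingold): NOFEasy ⊇ ACC⁰ (mod the named fact); whether NOFEasy ⊇ TC⁰ (hence contains a PRF) is
OPEN, so the placement of the road against natural proofs is undetermined and recorded as such;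
NOFTransfer carries the hypothesis NP ⊆ P under which hard PRFs do not exist — outside by
construction for the implication shape (same standing as N4 / N26 transfer pieces).
- Literature.Barriers.PneNP.Relativization (BGS75) /
Literature.Barriers.PneNP.BoundedRelativization: convention α of the cell — NOFEasy is an
oracle-free non-uniform class, the class axis is oracle-uninformative; TQBF reading of the pieces =
«PSPACE ⊄ / ⊆ NOFEasy», and PSPACE ⊄

History (route lifecycle, newest last):
- 2026-09-04T13:54:27Z · DORMANT — reconciler: no traction for 5 d (last activity statement-checked at 2026-08-30T13:21:56Z); parked, not closed — `ledger route dormant route-PneNP-RootDecompMult (operator:999:81895)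

sub-problem: PneNP · status: dormant · opened planner-decomp-pnenp-writer-1-g5-0 2026-08-30T09:12:27Z · rev 0 · ledger route-PneNP-RootDecompMultipartyNOF
GENERATED by the gate from the ledger (D-0016/17). Provers cite these decls: `theorem foo : Summit.PneNP.PneNP.Theses.RootDecompMultipartyNOF.<Decl> := …` in Summits/PneNP/PneNP/Theorems/<Name>.lean.
-/

namespace Summit.PneNP.PneNP.Theses.RootDecompMultipartyNOF

open scoped BigOperators Topology Manifold Classical MeasureTheory ProbabilityTheory Matrix InnerProductSpace ComplexConjugate ContinuousMap
open Filter Set Function TopologicalSpace MeasureTheory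

attribute [summit_statement] _root_.PneNP

open Literature.PNP

/-- item stmt-PneNP-31648 · crux · rank 2 · open · by planner
why it might fail: False exactly in a world NP ⊆ P ∧ P ⊆ NOFEasy, excluded by nothing known: no explicit function (let alone a P-language forced by a SAT algorithm) is known outside the log n barrier — deterministic simultaneous NOF lower bounds stop at k < log₂ N players (ACFN 2015, Jukna Rem. 5.20).
sources: doi:10.1007/s00037-013-0078-4 (Ada–Chattopadhyay–Fawzi–Nguyen, comput. complexity 2015, §1 p.2 «no non-trivial lower bound is known for an explicit function for k = log n», Thm 2) [corpus:paper:doi-10-1007-s00037-013-0078-4 pp.2,4,6]; tree Literature/Barriers/PneNP/NOFLogNBarrier.lean, Jukna2012 Ch. 5 (NOF model, Thm 5.15, Rem. 5.19–5.20 PDF pp.155–168), Ch. 12 (Lemma 12.34, Rem. 12.36 p.372) [corpus:book:jukna2012-boolean-function-complexity-advances-frontiers pp.168,372], arXiv:1710.01969 (Hamoudi 2018, Def. 1, Thm 12, §4 conjecture) [corpus:arXiv:1710.01969; galaxy:pdf:576415020], BabaiKimmelLokam1995 / BabaiGalKimmelLokam2003 (SMP model, MAJ∘MAJ_t candidate);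 tree @[conjecture] Literature.Barriers.PneNP.WideBlockMajMajConjecture (registered open) + Literature/Barriers/PneNP/WideBlockMajMajTwoPlayers.lean (k = 2 fragment proved), HastadGoldmann1991 / Williams2014 (ACC⁰ ⊆ SYM⁺; tree named fact Literature.Computability.Complexity.Williams2014_symPlus_of_acc, tree theorems Literature.Barriers.PneNP.hasSimultaneousProtocol_symPlus / hasSimultaneousProtocol_of_acc), HOME/decomp-pnenp-lens-4/CommunicationLift.lean sha256 87b2f764
[crux r2 · piece A_NOF «NOF transfer» · ATTACKED · tags WEAKER(formal: S ⟹ A, pack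
nofTransfer_of_pneNP) / NECESSARY (pneNP_iff) / not-COSTUME as typed (A ⟹ S is literally B; probe A
→ S FAILS) / UNDECIDED · leaves IDEA-NEEDED (a k ≥ log n simultaneous NOF lower-bound method) +
BARRIER-ADJACENT (tree NOFLogNBarrier = ACFN Thm 2(b) width one; NOFBlockWidthBarrier constant
width) + ATTACKABLE-ROUTINE bridge WideBlockBridge (lens def, UNPROVED: WideBlockMajMajConjecture →
BreakLogNBarrierInP; cited by name, not filed — it reaches a registered @[conjecture])] THE BIT: Y
:= «P ⊆ NOFEasy», NOFEasy («inside the log n barrier») := ⋃_e {L | every (k,n)-slice of L (k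
players, row-major k×n NOF matrix, k ≥ 2) with k > (log₂(kn)+2)ᵉ players has a valid SIMULTANEOUS
k-party NOF protocol of cost ≤ k·(log₂(kn)+2)ᵉ} — exactly the Håstad–Goldmann shape of every ACC⁰
function (tree hasSimultaneousProtocol_of_acc, mod the named fact ACC⁰ ⊆ SYM⁺). Piece A_NOF: «if SAT
is in P then some polynomial-time language lies OUTSIDE the log n barrier». Normal form in kernel
(pack nofTransfer_iff_or): A_NOF ⟺ S ∨ BreakLogNBarrierInP — so the S-free ROAD is exactly the aside
BreakLogNBarrierInP (pack nofTransfer_ -/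
@[route_item "route-PneNP-RootDecompMultipartyNOF"]
def NOFTransfer : Prop :=
  Literature.Computability.Complexity.Nondeterministic.NP ⊆ Literature.Computability.Complexity.Classes.P → ¬ (Literature.Computability.Complexity.Classes.P ⊆ ⋃ e : ℕ, {L : Language Bool | ∀ k n : ℕ, 2 ≤ k → (Nat.log 2 (k * n) + 2) ^ e < k → Literature.Barriers.PneNP.HasSimultaneousProtocol (fun X : Literature.Barriers.PneNP.NOFInput k n => Language.sliceFn L (k * n) (Literature.Barriers.PneNP.flattenNOF X)) (k * (Nat.log 2 (k * n) + 2) ^ e)})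

/-- item stmt-PneNP-31649 · crux · rank 3 · open · by planner
why it might fail: Equivalent to S as soon as BreakLogNBarrierInP (an explicit P-function beyond the log n barrier, universally expected) is proved — pre-costume declared in kernel; strictly below S only formally (class axis, convention α; TQBF reading = PSPACE vs NOFEasy, open).
sources: Jukna2012 Ch. 5 (NOF model, Thm 5.15, Rem. 5.19–5.20 PDF pp.155–168), Ch. 12 (Lemma 12.34, Rem. 12.36 p.372) [corpus:book:jukna2012-boolean-function-complexity-advances-frontiers pp.168,372], doi:10.1007/s00037-013-0078-4 (Ada–Chattopadhyay–Fawzi–Nguyen, comput. complexity 2015, §1 p.2 «no non-trivial lower bound is known for an explicit function for k = log n», Thm 2) [corpus:paper:doi-10-1007-s00037-013-0078-4 pp.2,4,6]; tree Literature/Barriers/PneNP/NOFLogNBarrier.lean, HastadGoldmann1991 / Williams2014 (ACC⁰ ⊆ SYM⁺; tree named fact Literature.Computability.Complexity.Williams2014_symPlus_of_acc, tree theorems Literature.Barriers.PneNP.hasSimultaneousProtocol_symPlus / hasSimultaneousProtocol_of_acc), HOME/decomp-pnenp-lens-4/CommunicationLift.lean sha256 87b2f764, HOME/decomp-pnenp-lens-4/NODE-g9.md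 sha256 43b3f46f
[crux r3 · piece B_NOF «NOF shallowness of Algorithmica» · DECLARED RESIDUAL (tribunal_fit.residual;
NO residual score claimed — S-inert class) · tags WEAKER(formal: S ⟹ B, pack nofShallow_of_pneNP) /
NECESSARY / PRE-COSTUME DECLARED / UNDECIDED] THE BIT: Y := «P ⊆ NOFEasy», NOFEasy («inside the log
n barrier») := ⋃_e {L | every (k,n)-slice of L (k players, row-major k×n NOF matrix, k ≥ 2) with k >
(log₂(kn)+2)ᵉ players has a valid SIMULTANEOUS k-party NOF protocol of cost ≤ k·(log₂(kn)+2)ᵉ} —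
exactly the Håstad–Goldmann shape of every ACC⁰ function (tree hasSimultaneousProtocol_of_acc, mod
the named fact ACC⁰ ⊆ SYM⁺). Piece B_NOF: «were SAT easy, every polynomial-time language would sit
inside the log n barrier»; normal form in kernel (pack nofShallow_iff_imp): B_NOF ⟺
(BreakLogNBarrierInP → S), i.e. «a P-language breaking the log n barrier separates P from NP».
PRE-COSTUME BY KERNEL (pack nofShallow_iff_pneNP_of_break): the day the barrier is broken inside P,
B_NOF IS S (LAW IV zero-sum, pack zeroSum_shallow) — declared, not hidden. Lattice (lens kernel, mod
Williams2014_symPlus_of_acc via the tree's PROVED Håstad–Goldmann simulation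
hasSimultaneousProtocol_of_acc): N4.ShallowAlg -/
@[route_item "route-PneNP-RootDecompMultipartyNOF"]
def NOFShallow : Prop :=
  Literature.Computability.Complexity.Nondeterministic.NP ⊆ Literature.Computability.Complexity.Classes.P → Literature.Computability.Complexity.Classes.P ⊆ ⋃ e : ℕ, {L : Language Bool | ∀ k n : ℕ, 2 ≤ k → (Nat.log 2 (k * n) + 2) ^ e < k → Literature.Barriers.PneNP.HasSimultaneousProtocol (fun X : Literature.Barriers.PneNP.NOFInput k n => Language.sliceFn L (k * n) (Literature.Barriers.PneNP.flattenNOF X)) (k * (Nat.log 2 (k * n) + 2) ^ e)}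

/-- item stmt-PneNP-31650 · aside · rank 9 · open · by planner
why it might fail: It is the log n barrier itself: no deterministic simultaneous NOF lower-bound method is known for k ≥ log₂ N players (discrepancy / cube-norm methods decay as 2^{-k}); inside the tree barriers NOFLogNBarrier (width one) and NOFBlockWidthBarrier (constant width).
sources: doi:10.1007/s00037-013-0078-4 (Ada–Chattopadhyay–Fawzi–Nguyen, comput. complexity 2015, §1 p.2 «no non-trivial lower bound is known for an explicit function for k = log n», Thm 2) [corpus:paper:doi-10-1007-s00037-013-0078-4 pp.2,4,6]; tree Literature/Barriers/PneNP/NOFLogNBarrier.lean, Jukna2012 Ch. 5 (NOF model, Thm 5.15, Rem. 5.19–5.20 PDF pp.155–168), Ch. 12 (Lemma 12.34, Rem. 12.36 p.372) [corpus:book:jukna2012-boolean-function-complexity-advances-frontiers pp.168,372], arXiv:1710.01969 (Hamoudi 2018, Def. 1, Thm 12, §4 conjecture) [corpus:arXiv:1710.01969; galaxy:pdf:576415020], arXiv:1711.10661 (Podolskii–Sherstov 2020, Thm 1.1: randomised Θ(log n) past the barrier) [corpus:arXiv:1711.10661], BabaiKimmelLokam1995 / BabaiGalKimmelLokam2003 (SMP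 model, MAJ∘MAJ_t candidate); tree @[conjecture] Literature.Barriers.PneNP.WideBlockMajMajConjecture (registered open) + Literature/Barriers/PneNP/WideBlockMajMajTwoPlayers.lean (k = 2 fragment proved), HOME/decomp-pnenp-lens-4/CommunicationLift.lean sha256 87b2f764
[aside · banked, never staffed as a piece · the LOCATED S-FREE SUB-TARGET «break the log n barrier
inside P», famous and open] ∃ L ∈ P outside NOFEasy: for every exponent e some slice of L with k >
(log₂ N+2)ᵉ players has no valid simultaneous protocol of cost k(log₂ N+2)ᵉ — the language-level
form of the central open problem of the simultaneous NOF model (ACFN 2015 §1; Jukna Rem. 5.20 /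
12.36; past the barrier only randomised Θ(log n) protocols are separated, Podolskii–Sherstov 2020).
Edges in kernel (pack): BreakLogNBarrierInP ⟹ NOFTransfer (road), NOFTransfer ⟺ S ∨
BreakLogNBarrierInP, BreakLogNBarrierInP ⟹ (NOFShallow ⟺ S) (pre-costume law). Candidate in the
tree: the registered open @[conjecture] WideBlockMajMajConjecture (BKL wide-block MAJ∘MAJ_t hard for
every polylog number of players; k = 2 fragment PROVED in WideBlockMajMajTwoPlayers.lean) through
the lens's UNPROVED routine bridge WideBlockBridge (one P-language laying out all (c,t) instances at
distinct lengths; quantifier audit ∃e-vs-∀c recorded by the lens) — bridge and conjecture cited BY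
NAME, not filed as items. INSTRUMENTABLE (recorded, not run): exact small-(k,n,t) SMP costs of
majMajNOF by SAT/ILP ≈ 5–20 core-h. -/
@[route_item "route-PneNP-RootDecompMultipartyNOF"]
def BreakLogNBarrierInP : Prop :=
  ∃ L ∈ Literature.Computability.Complexity.Classes.P, L ∉ ⋃ e : ℕ, {L : Language Bool | ∀ k n : ℕ, 2 ≤ k → (Nat.log 2 (k * n) + 2) ^ e < k → Literature.Barriers.PneNP.HasSimultaneousProtocol (fun X : Literature.Barriers.PneNP.NOFInput k n => Language.sliceFn L (k * n) (Literature.Barriers.PneNP.flattenNOF X)) (k * (Nat.log 2 (k * n) + 2) ^ e)}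

/-- item stmt-PneNP-31651 · aside · rank 9 · closed · proved by Summit.PneNP.PneNP.Theorems.transferAtOne_proof (prover) · by planner
why it might fail: Decided in the lens kernel (transferAt_one via the EQL fooling-set bound; axioms propext / Classical.choice / Quot.sound); only the port into a Theorems file remains — a porting slip is the only failure mode.
sources: HOME/decomp-pnenp-lens-4/CommunicationLift.lean sha256 87b2f764, HOME/critic/L4_MultipartyNOF_g9_probe.lean sha256 5a3fffb0, Jukna2012 Ch. 5 (NOF model, Thm 5.15, Rem. 5.19–5.20 PDF pp.155–168), Ch. 12 (Lemma 12.34, Rem. 12.36 p.372) [corpus:book:jukna2012-boolean-function-complexity-advances-frontiers pp.168,372]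
[aside · DECIDED TRUE in the lens kernel (transferAt_one: the numeric-equality P-language EQL needs
two-party simultaneous cost ≥ m — fooling set + card_le_two_pow_cost; ≈ 250 lines in
HOME/decomp-pnenp-lens-4/CommunicationLift.lean sha256 87b2f764, critic-certified 72/72 AXOK; port
target for an idle prover seat) · the BOTTOM calibration of the player-threshold dial τ ≡ 1 (two
parties admitted), where the transfer is a theorem and the shallow twin IS S
(shallowAt_one_iff_pneNP): costume end located BY THEOREM; the cut NOFEasy sits strictly above
(thresholds plog e ≥ 1)] TransferAtOne := NP ⊆ P ⟹ P ⊄ EasyAt(τ ≡ 1) (inlined: some P-language has,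
for every e, a slice with k ≥ 2 players and no valid simultaneous protocol of cost k(log₂ N+2)ᵉ).
Also implied by the cut's transfer in kernel (pack transferAtOne_of_nofTransfer, dial antitonicity
transferAt_anti). PROVENANCE: root-decomposition cell decomp-pnenp (D-0178), proposal P31 = lens-4
gen 9 NODE «RootDecompMultipartyNOF» (HOME/decomp-pnenp-lens-4/CommunicationLift.lean sha256
87b2f764; HOME/decomp-pnenp-lens-4/NODE-g9.md sha256 43b3f46f); critic decomp-pnenp-crit-1 g4
NODE-VERDICT 2026-08-30T07:51:49Z CLEARED as an S-INERT CELL on -/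
@[route_item "route-PneNP-RootDecompMultipartyNOF"]
def TransferAtOne : Prop :=
  Literature.Computability.Complexity.Nondeterministic.NP ⊆ Literature.Computability.Complexity.Classes.P → ¬ (Literature.Computability.Complexity.Classes.P ⊆ ⋃ e : ℕ, {L : Language Bool | ∀ k n : ℕ, 2 ≤ k → 1 < k → Literature.Barriers.PneNP.HasSimultaneousProtocol (fun X : Literature.Barriers.PneNP.NOFInput k n => Language.sliceFn L (k * n) (Literature.Barriers.PneNP.flattenNOF X)) (k * (Nat.log 2 (k * n) + 2) ^ e)})

-- `TransferAtOne` holds: proved by `Summit.PneNP.PneNP.Theorems.transferAtOne_proof` (its module imports this route file, so no `_holds` link can be stated here).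

/-- item stmt-PneNP-31652 · assembly · rank 1 · open · by planner
why it might fail: Cannot fail: closes is six lines over the tree bridge pneNP_shape_iff_P_ne_NP, certified native by route check.
sources: HOME/decomp-pnenp-lens-4/CommunicationLift.lean sha256 87b2f764, writer folder/n31_nof/N31_items.lean sha256 facd41b4
[assembly] the two pieces give the summit: under NP ⊆ P they contradict each other, and ¬(NP ⊆ P) is
S by the tree bridge pneNP_shape_iff_P_ne_NP — glue.lean `closes` (both binders used); exactness
`pneNP_iff : PneNP ↔ NOFTransfer ∧ NOFShallow` hyp-free in the pack. PROVENANCE: root-decomposition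
cell decomp-pnenp (D-0178), proposal P31 = lens-4 gen 9 NODE «RootDecompMultipartyNOF»
(HOME/decomp-pnenp-lens-4/CommunicationLift.lean sha256 87b2f764;
HOME/decomp-pnenp-lens-4/NODE-g9.md sha256 43b3f46f); critic decomp-pnenp-crit-1 g4 NODE-VERDICT
2026-08-30T07:51:49Z CLEARED as an S-INERT CELL on a NEW coordinate «number of NOF players admitted
(the log n barrier)» (0 blocking objections; scores once under cap (vii) as a located S-free
sub-target, no residual score claimed; HOME/critic/L4_MultipartyNOF_g9_probe.lean sha256 5a3fffb0,
farm rc0 / 0 sorry / 72 AXOK); census COSTUME-CENSUS v10 row NMN «MultipartyNOF (log n barrier)»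
(class S-INERT/located, road BreakLogNBarrierInP, bridge WideBlockBridge open); writer pack writer
folder/n31_nof/N31_items.lean sha256 facd41b4 (rc0, 0 sorry, 10 AXOK, BC7 2/2 CLEAN; the lens set
NOFEasy INLINED over the tree's NOFInput / HasSimultaneousProtocol -/
@[route_item "route-PneNP-RootDecompMultipartyNOF"]
def Assembly : Prop :=
  NOFTransfer → NOFShallow → PneNP

/-! D-0027 §2.1 — DECIDING THEOREM (planner-authored via `route open/edit --closes-file`; by planner-decomp-pnenp-writer-1-g5-0 2026-08-30T09:12:27Z):
its hypotheses are this route's items and its conclusion the sub-problem Statement (glue_lint), and it elaborates with this file. -/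

@[closes "route-PneNP-RootDecompMultipartyNOF"] theorem closes (hA : NOFTransfer) (hR : NOFShallow) : _root_.PneNP := by
  by_contra hS
  have hPNP : Literature.Computability.Complexity.Classes.P =
      Literature.Computability.Complexity.Nondeterministic.NP := by
    by_contra hne
    exact hS (Literature.Computability.Complexity.pneNP_shape_iff_P_ne_NP.2 hne)
  have hNP : Literature.Computability.Complexity.Nondeterministic.NP ⊆
      Literature.Computability.Complexity.Classes.P := fun L hL => by rw [hPNP]; exact hL
  exact hA hNP (hR hNP)

end Summit.PneNP.PneNP.Theses.RootDecompMultipartyNOF
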